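import Summits.NavierStokesRegularity.NavierStokesRegularity.Theorems.SoloRefuteTaghizadeh2026StepL41Vertex
import Summits.NavierStokesRegularity.NavierStokesRegularity.Theorems.SoloRefuteTaghizadeh2026Step29EWitness
import HarnessLib

/-!
# C166 `Taghizadeh2026` — refutation of the imported almost-monotonicity step (`Step29E_AlmostMono`)

D-0090 NS-CLAIMS SWEEP, claim C166 (E. Taghizadeh, *Exclusion of Singularities in the Three-Dimensional
Navier–Stokes Equations: Vanishing of the Local Monotonicity Limit*, Zenodo 18468522 v2, 13 pp.; typed
skeleton `Literature/Claims/NS/Taghizadeh2026.lean`, rev 2 p543049), kit part 2E (ns-claims-refuter-1 g5,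
filed through a salvage seat, conv. (b)); part 1 = `SoloRefuteTaghizadeh2026StepL41Vertex` (vertex divergence),
part 2W = `SoloRefuteTaghizadeh2026Step29EWitness` (class membership of Clay solutions + the non-vanishing witness).

**The typed step (honest carrier, rev 2).** `Step29E_AlmostMono ν lam χ` (§2.9 p.6 l.36–56, IMPORTED from the
companion (63)–(64) p.16 l.46–65): for every solution `(u, p, ∇u = G)` of the print's class `IsSolution ν T`
(CKN-suitable on the slab `(0,T) × ℝ³`, `u ∈ L^∞_t L²_x`, `∇u ∈ L²_{t,x}`) and every slab point `z0`, there are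
`c, C, α, r* > 0` with `ofReal c · ∫_{r₁}^{r₂} ρ⁻¹ D(ρ; z0) dρ ≤ ofReal (I(r₂; z0) − I(r₁; z0) + C∫_{r₁}^{r₂} ρ^α)`
for all `0 < r₁ < r₂ < r*`, where `D(ρ; z0) = ∫∫_{Q_ρ(z0)} |∇u − u ⊗ ∇log Φ_{ρ,z0}|² Φ_{ρ,z0} ∈ [0, ∞]`
(`DfunE`, extended Lebesgue integral) and `Φ_{ρ,z0} = G_{z0} χ(s)` is built on the print's UNSHIFTED backward
heat kernel `G_{z0}(x,t) = (4πν(t0−t))^{−3/2} e^{−|x−x0|²/(4ν(t0−t))}` (§2.4 p.4 l.80 – p.5 l.10; vertex AT `z0`).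

**The countermodel (kernel-checked below): a genuine smooth finite-energy solution at a point where it does
not vanish.** Take the Kato small-data solution `(u, p)` of the unforced system from the datum
`c₀ · u₀^{Godoi}` (explicit Schwartz, divergence-free; tree `exists_clayA_smul` + `Godoi2016.datum1`): smooth
on `[0,∞) × ℝ³`, bounded energy — a member of the print's class on every slab (CKN suitability of classical
solutions; `∇u ∈ L²_{t,x}` by the energy equality, tree `energyClass_of_finiteEnergy` = Tao 2013 Lemma 8.1).
By continuity there is an interior point `z0 = (t0, x*)` and `δ, m > 0`, `K ≥ 0` with `|u| ≥ m`, `|∇u| ≤ K` on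
the `δ`-ball about `z0`. On the parabolic shell `S_T(z0) = {t0 − T < t < t0, ν(t0−t)/4 ≤ |x−x0|² ≤ ν(t0−t)}`
(`T` small) one has `s < 1`, so `Φ_{ρ,z0} = G_{z0}`, `∇log Φ_{ρ,z0} = −(x−x0)/(2ν(t0−t))` (the print's own
formula p.11 l.24–28), `|∇log Φ|² ≥ 1/(16ν(t0−t))`, hence (elementary algebra `|A − u⊗g|² ≥ |u|²|g|²/2 − |A|²`)
the integrand of `D(ρ; z0)` is `≥ (m²/4)|∇log G_{z0}|² G_{z0}`, whose integral over the shell is `+∞`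
(part 1: each time slice contributes `≥ C₀/(ν(t0−t))`, `∫_0 dτ/τ = ∞`). So `D(ρ; z0) = +∞` for EVERY `ρ > 0`,
`∫_{r₁}^{r₂} ρ⁻¹ D = +∞`, and `ofReal c · ⊤ = ⊤ ≤ ofReal(finite)` is false for every choice of `c, C, α, r*`:
`¬ Step29E_AlmostMono ν lam χ` for EVERY `ν > 0`, `λ > 0` and EVERY admissible cutoff `χ`.

**Classification: refuted-substantive (false imported lemma, countermodel in the print's own class;
the divergence is print-level, not a carrier artefact).** The weight `|∇log Φ_{r,z0}|² Φ_{r,z0}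
∼ |x−x0|² G_{z0}/(t0−t)²` is not integrable at the unshifted vertex, so the square term of §2.9 / companion
(63) is `+∞` at every regular point with `u(z0) ≠ 0` while `I(r; z0)` stays finite; the print's §2.4 bullet
«|∇Φ_{r,z0}| ≲ r⁻⁴ on Q_r(z0)» (p.5 l.13) is false on the axis. Repairs tried: (N) normalised kernel `r³Φ` —
same vertex, same divergence; a SHIFTED vertex `G_{(t0+r², x0)}` (CKN's choice) removes the divergence but is
not the printed object and changes every quantity §2.9 is imported for. No cheap repair: the step is the
engine of §3.1–§4.2. Tree convention `z = (t, x) : ℝ × EuclideanSpace ℝ (Fin 3)`.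
WHAT THIS IS NOT: not a claim about NS regularity or blow-up; not a claim about any author beyond the typed
locator. [cite: Taghizadeh2026, §2.9 p.6 l.36–56; §2.4 p.4 l.80 – p.5 l.15]
-/

noncomputable section

set_option linter.dupNamespace false

namespace Summit.NavierStokesRegularity.NavierStokesRegularity.Theorems.Taghizadeh2026

namespace KillE

open MeasureTheory Set Metric Real Filter Function
open scoped ENNReal NNReal RealInnerProductSpace Topology ContDiff
open Literature.Analysis.FluidPDE Literature.Barriers.NavierStokesRegularity
open Literature.Claims.NS Literature.Claims.NS.Taghizadeh2026

/-! ### The localised kernel near the vertex (print §2.4–§2.5) -/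

/-- The skeleton's `heatKer` (rpow spelling) is part 1's `bhk` below the vertex time. -/
lemma heatKer_eq_bhk {ν : ℝ} (hν : 0 < ν) (z0 : ℝ × E3) {t : ℝ} (ht : t < z0.1) (x : E3) :
    heatKer ν z0 t x = Vertex.bhk ν z0 (t, x) := by
  have hτ : 0 < z0.1 - t := by linarith
  have ha : 0 < 4 * Real.pi * ν * (z0.1 - t) := by positivity
  have hr : (4 * Real.pi * ν * (z0.1 - t)) ^ (-(3 : ℝ) / 2) =
      1 / ((4 * Real.pi * ν * (z0.1 - t)) * Real.sqrt (4 * Real.pi * ν * (z0.1 - t))) := by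
    rw [show -(3 : ℝ) / 2 = -((3 : ℝ) / 2) by ring, Real.rpow_neg ha.le,
      show (3 : ℝ) / 2 = 1 + 1 / 2 by norm_num, Real.rpow_add ha, Real.rpow_one, Real.sqrt_eq_rpow, inv_eq_one_div]
  unfold heatKer Vertex.bhk
  rw [if_pos ht, hr]
  simp only
  ring

/-- `∇ G_{z0}(t,·)(y) = G_{z0}(t,y) · (−(y − x0)/(2ν(t0 − t)))`. -/
lemma hasGradientAt_bhk {ν : ℝ} (hν : 0 < ν) {z0 : ℝ × E3} {t : ℝ} (ht : t < z0.1) (y : E3) :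
    HasGradientAt (fun x => Vertex.bhk ν z0 (t, x))
      (Vertex.bhk ν z0 (t, y) • ((-(1 / (2 * ν * (z0.1 - t)))) • (y - z0.2))) y := by
  have hlog := Vertex.hasGradientAt_log_bhk hν ht y
  rw [hasGradientAt_iff_hasFDerivAt] at hlog ⊢
  have hexp := hlog.exp
  have hfun : (fun x => Real.exp (Real.log (Vertex.bhk ν z0 (t, x)))) = fun x => Vertex.bhk ν z0 (t, x) :=
    funext fun x => Real.exp_log (Vertex.bhk_pos hν ht x)
  rw [hfun, Real.exp_log (Vertex.bhk_pos hν ht y)] at hexp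
  rw [map_smul]
  exact hexp

/-- The normalised parabolic distance is continuous in `x`. -/
lemma continuous_sdist (r : ℝ) (z0 : ℝ × E3) (t : ℝ) : Continuous fun x => sdist r z0 t x := by
  unfold sdist
  fun_prop

/-- Below the vertex and inside `{s < 1}` the localised kernel IS the heat kernel (`χ ≡ 1` on `[0,1]`). -/
lemma Phi_eq_heatKer {ν : ℝ} {χ : ℝ → ℝ} (hχ : IsCutoff χ) {r : ℝ} (z0 : ℝ × E3) {t : ℝ} (ht : t < z0.1)
    {x : E3} (hs : sdist r z0 t x < 1) : Phi ν χ r z0 t x = heatKer ν z0 t x := by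
  have hs0 : 0 ≤ sdist r z0 t x := by
    unfold sdist
    have : 0 ≤ z0.1 - t := by linarith
    positivity
  unfold Phi
  rw [hχ.eq_one _ ⟨hs0, hs.le⟩, mul_one]

/-- **The print's formula** «∇ log G(x,t) = −(x − x0)/(2ν(t0 − t))» (p.11 l.24–28) for the typed `gradLogPhi`,
strictly inside `{s < 1}` below the vertex. -/
lemma gradLogPhi_eq {ν : ℝ} (hν : 0 < ν) {χ : ℝ → ℝ} (hχ : IsCutoff χ) {r : ℝ} (z0 : ℝ × E3) {t : ℝ}
    (ht : t < z0.1) {x : E3} (hs : sdist r z0 t x < 1) :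
    gradLogPhi ν χ r z0 t x = (-(1 / (2 * ν * (z0.1 - t)))) • (x - z0.2) := by
  have hU : {y : E3 | sdist r z0 t y < 1} ∈ 𝓝 x :=
    (isOpen_lt (continuous_sdist r z0 t) continuous_const).mem_nhds hs
  have hev : (fun y => Phi ν χ r z0 t y) =ᶠ[𝓝 x] fun y => Vertex.bhk ν z0 (t, y) :=
    Filter.eventuallyEq_of_mem hU fun y hy => by
      rw [Phi_eq_heatKer hχ z0 ht hy, heatKer_eq_bhk hν z0 ht]
  have hG : 0 < Vertex.bhk ν z0 (t, x) := Vertex.bhk_pos hν ht x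
  unfold gradLogPhi
  rw [Phi_eq_heatKer hχ z0 ht hs, heatKer_eq_bhk hν z0 ht, hev.gradient_eq, (hasGradientAt_bhk hν ht x).gradient,
    smul_smul, inv_mul_cancel₀ hG.ne', one_smul]

/-- `‖∇log G_{z0}‖² G_{z0} = vtx` (part 1's model integrand), pointwise below the vertex. -/
lemma norm_gradlog_sq_mul_bhk {ν : ℝ} (hν : 0 < ν) {z0 : ℝ × E3} {t : ℝ} (ht : t < z0.1) (x : E3) :
    ‖(-(1 / (2 * ν * (z0.1 - t)))) • (x - z0.2)‖ ^ 2 * Vertex.bhk ν z0 (t, x) = Vertex.vtx ν z0 (t, x) := by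
  have hτ : 0 < z0.1 - t := by linarith
  rw [norm_smul, mul_pow, Real.norm_eq_abs, sq_abs]
  unfold Vertex.vtx
  simp only
  field_simp
  ring

/-- On the shell, `|∇log G_{z0}|² ≥ 1/(16ν(t0 − t))`. -/
lemma gradlog_sq_ge_on_core {ν T : ℝ} (hν : 0 < ν) {z0 z : ℝ × E3} (hz : z ∈ Vertex.core ν T z0) :
    1 / (16 * ν * (z0.1 - z.1)) ≤ ‖(-(1 / (2 * ν * (z0.1 - z.1)))) • (z.2 - z0.2)‖ ^ 2 := by
  obtain ⟨h1, h2, h3, -⟩ := hz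
  have hτ : 0 < z0.1 - z.1 := by linarith
  rw [norm_smul, mul_pow, Real.norm_eq_abs, sq_abs]
  rw [show (-(1 / (2 * ν * (z0.1 - z.1)))) ^ 2 * ‖z.2 - z0.2‖ ^ 2
      = ‖z.2 - z0.2‖ ^ 2 / (4 * ν ^ 2 * (z0.1 - z.1) ^ 2) by field_simp; ring]
  rw [div_le_div_iff₀ (by positivity) (by positivity)]
  nlinarith [h3, hτ, hν, mul_pos hν hτ]

/-! ### Frobenius algebra: `|A − u ⊗ g|² ≥ (m²/4)|g|²` when `|u| ≥ m` dominates `|A|` -/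

/-- `(u ⊗ g) h = ⟨g, h⟩ u`. -/
@[simp] lemma tensor_apply (u g h : E3) : tensor u g h = ⟪g, h⟫ • u := by
  simp [tensor, innerSL_apply_apply]

/-- `|u ⊗ g|²_F = ‖u‖² ‖g‖²`. -/
lemma frobeniusNormSq_tensor (u g : E3) : frobeniusNormSq (tensor u g) = ‖u‖ ^ 2 * ‖g‖ ^ 2 := by
  unfold frobeniusNormSq
  simp_rw [tensor_apply, norm_smul, mul_pow, Real.norm_eq_abs, sq_abs]
  rw [← Finset.sum_mul, (stdOrthonormalBasis ℝ E3).sum_sq_inner_left g]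
  ring

/-- `|A − B|²_F ≥ |B|²_F / 2 − |A|²_F`. -/
lemma frobeniusNormSq_sub_ge (A B : E3 →L[ℝ] E3) :
    frobeniusNormSq B / 2 - frobeniusNormSq A ≤ frobeniusNormSq (A - B) := by
  unfold frobeniusNormSq
  have key : ∀ i, ‖B (stdOrthonormalBasis ℝ E3 i)‖ ^ 2 / 2 - ‖A (stdOrthonormalBasis ℝ E3 i)‖ ^ 2 ≤
      ‖(A - B) (stdOrthonormalBasis ℝ E3 i)‖ ^ 2 := by
    intro i
    set a := A (stdOrthonormalBasis ℝ E3 i)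
    set b := B (stdOrthonormalBasis ℝ E3 i)
    have h1 : ‖b‖ ≤ ‖a - b‖ + ‖a‖ := by
      calc ‖b‖ = ‖a - (a - b)‖ := by rw [sub_sub_cancel]
        _ ≤ ‖a‖ + ‖a - b‖ := norm_sub_le _ _
        _ = ‖a - b‖ + ‖a‖ := add_comm _ _
    have h2 : (A - B) (stdOrthonormalBasis ℝ E3 i) = a - b := by simp [a, b]
    rw [h2]
    nlinarith [h1, norm_nonneg b, norm_nonneg (a - b), norm_nonneg a, sq_nonneg (‖a - b‖ - ‖a‖)]
  calc (∑ i, ‖B (stdOrthonormalBasis ℝ E3 i)‖ ^ 2) / 2 - ∑ i, ‖A (stdOrthonormalBasis ℝ E3 i)‖ ^ 2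
      = ∑ i, (‖B (stdOrthonormalBasis ℝ E3 i)‖ ^ 2 / 2 - ‖A (stdOrthonormalBasis ℝ E3 i)‖ ^ 2) := by
        rw [Finset.sum_sub_distrib, Finset.sum_div]
    _ ≤ ∑ i, ‖(A - B) (stdOrthonormalBasis ℝ E3 i)‖ ^ 2 := Finset.sum_le_sum (fun i _ => key i)

/-- If `m² ≤ ‖u‖²`, `|A|²_F ≤ B`, `L ≤ ‖g‖²` and `4B ≤ m² L`, then `|A − u ⊗ g|²_F ≥ (m²/4)‖g‖²`. -/
lemma frobeniusNormSq_sub_tensor_ge {u g : E3} {A : E3 →L[ℝ] E3} {m B L : ℝ}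
    (hu : m ^ 2 ≤ ‖u‖ ^ 2) (hA : frobeniusNormSq A ≤ B) (hg : L ≤ ‖g‖ ^ 2) (hBL : 4 * B ≤ m ^ 2 * L) :
    m ^ 2 / 4 * ‖g‖ ^ 2 ≤ frobeniusNormSq (A - tensor u g) := by
  have h := frobeniusNormSq_sub_ge A (tensor u g)
  rw [frobeniusNormSq_tensor] at h
  have hg0 : 0 ≤ ‖g‖ ^ 2 := by positivity
  nlinarith [h, hu, hA, hg, hBL, hg0, mul_le_mul_of_nonneg_right hu hg0, sq_nonneg m]

/-! ### `D(ρ; z0) = +∞` at a point of non-vanishing -/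

/-- **The square term is infinite at every point where the solution does not vanish.** If `|u| ≥ m > 0` and
`|∇u|²_F ≤ B` on the `δ`-ball about `z0`, then `D(ρ; z0) = ⊤` for EVERY `ρ > 0` (print §2.9 / companion (63)
with the print's unshifted kernel §2.4). -/
theorem DfunE_eq_top {ν : ℝ} (hν : 0 < ν) {χ : ℝ → ℝ} (hχ : IsCutoff χ) {u : ℝ → E3 → E3}
    {G : ℝ → E3 → E3 →L[ℝ] E3} {z0 : ℝ × E3} {δ m B : ℝ} (hδ : 0 < δ) (hm : 0 < m) (hB : 0 ≤ B)
    (hnear : ∀ z : ℝ × E3, dist z z0 < δ → m ≤ ‖u z.1 z.2‖ ∧ frobeniusNormSq (G z.1 z.2) ≤ B)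
    {ρ : ℝ} (hρ : 0 < ρ) : DfunE ν χ ρ z0 u G = ⊤ := by
  -- the shell depth `T`
  obtain ⟨T, hT, hTδ, hTδ2, hTρ, hTm⟩ : ∃ T : ℝ, 0 < T ∧ T ≤ δ ∧ (1 + ν) * T ≤ δ ^ 2 ∧
      T ≤ ρ ^ 2 / (1 + ν) ∧ (64 * ν * B + 1) * T ≤ m ^ 2 := by
    refine ⟨min (min δ (δ ^ 2 / (1 + ν))) (min (ρ ^ 2 / (1 + ν)) (m ^ 2 / (64 * ν * B + 1))),
      by positivity, (min_le_left _ _).trans (min_le_left _ _), ?_, (min_le_right _ _).trans (min_le_left _ _), ?_⟩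
    · rw [← le_div_iff₀' (by positivity)]
      exact (min_le_left _ _).trans (min_le_right _ _)
    · rw [← le_div_iff₀' (by positivity)]
      exact (min_le_right _ _).trans (min_le_right _ _)
  -- the shell sits inside `Q_ρ(z0)`
  have hQ : Vertex.core ν T z0 ⊆ parabolicCylinder ρ z0 := by
    intro z hz
    obtain ⟨h1, h2, h3, -⟩ := Vertex.core_bounds hν hρ hTρ hz
    exact mk_mem_prod ⟨h1, h2⟩ (mem_ball_iff_norm.2 h3)
  unfold DfunE
  refine Vertex.lintegral_eq_top_of_ge hν hT (by positivity : 0 < m ^ 2 / 4) z0 hQ fun z hz => ?_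
  have hzc := hz
  obtain ⟨h1, h2, h3, h4⟩ := hz
  have hτ : 0 < z0.1 - z.1 := by linarith
  have hτT : z0.1 - z.1 < T := by linarith
  have hρ2 : (1 + ν) * T ≤ ρ ^ 2 := by rwa [← le_div_iff₀' (by positivity)]
  -- `s < 1` on the shell
  have hs : sdist ρ z0 z.1 z.2 < 1 := by
    unfold sdist
    rw [← add_div, div_lt_one (by positivity)]
    nlinarith [h4, hτT, hν]
  -- the shell point is `δ`-close to `z0`
  have hdist : dist z z0 < δ := by
    rw [Prod.dist_eq, max_lt_iff]
    refine ⟨?_, ?_⟩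
    · rw [Real.dist_eq, abs_sub_comm, abs_of_pos hτ]
      linarith
    · rw [dist_eq_norm]
      have hx2 : ‖z.2 - z0.2‖ ^ 2 < δ ^ 2 := by nlinarith [h4, hτT, hν, hτ]
      exact lt_of_pow_lt_pow_left₀ 2 hδ.le hx2
  obtain ⟨hum, hGB⟩ := hnear z hdist
  -- the pointwise lower bound `(m²/4)|∇log G|² G ≤ |G − u ⊗ ∇log Φ|² Φ`
  set g : E3 := (-(1 / (2 * ν * (z0.1 - z.1)))) • (z.2 - z0.2) with hgdef
  have hu2 : m ^ 2 ≤ ‖u z.1 z.2‖ ^ 2 := pow_le_pow_left₀ hm.le hum 2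
  have hL : 1 / (16 * ν * (z0.1 - z.1)) ≤ ‖g‖ ^ 2 := gradlog_sq_ge_on_core hν hzc
  have hBL : 4 * B ≤ m ^ 2 * (1 / (16 * ν * (z0.1 - z.1))) := by
    rw [mul_one_div, le_div_iff₀ (by positivity)]
    nlinarith [hTm, hτT.le, hB, mul_nonneg (mul_nonneg (by norm_num : (0:ℝ) ≤ 64) hν.le) hB]
  have hfrob : m ^ 2 / 4 * ‖g‖ ^ 2 ≤ frobeniusNormSq (G z.1 z.2 - tensor (u z.1 z.2) g) :=
    frobeniusNormSq_sub_tensor_ge hu2 hGB hL hBL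
  have hbhk : 0 ≤ Vertex.bhk ν z0 (z.1, z.2) := Vertex.bhk_nonneg hν h2
  have hv : Vertex.vtx ν z0 z = ‖g‖ ^ 2 * Vertex.bhk ν z0 (z.1, z.2) :=
    (norm_gradlog_sq_mul_bhk hν h2 z.2).symm
  refine ENNReal.ofReal_le_ofReal ?_
  rw [Phi_eq_heatKer hχ z0 h2 hs, heatKer_eq_bhk hν z0 h2, gradLogPhi_eq hν hχ z0 h2 hs, ← hgdef, hv]
  calc m ^ 2 / 4 * (‖g‖ ^ 2 * Vertex.bhk ν z0 (z.1, z.2))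
      = (m ^ 2 / 4 * ‖g‖ ^ 2) * Vertex.bhk ν z0 (z.1, z.2) := by ring
    _ ≤ frobeniusNormSq (G z.1 z.2 - tensor (u z.1 z.2) g) * Vertex.bhk ν z0 (z.1, z.2) :=
        mul_le_mul_of_nonneg_right hfrob hbhk

/-- An infinite square term on every scale makes the weighted scale integral infinite. -/
theorem sqTermE_eq_top {ν : ℝ} {χ : ℝ → ℝ} {z0 : ℝ × E3} {u : ℝ → E3 → E3} {G : ℝ → E3 → E3 →L[ℝ] E3}
    (hD : ∀ ρ : ℝ, 0 < ρ → DfunE ν χ ρ z0 u G = ⊤) {r₁ r₂ : ℝ} (hr₁ : 0 < r₁) (hr : r₁ < r₂) :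
    sqTermE ν χ r₁ r₂ z0 u G = ⊤ := by
  unfold sqTermE
  have h : EqOn (fun ρ => ENNReal.ofReal ρ⁻¹ * DfunE ν χ ρ z0 u G) (fun _ => ⊤) (Ioo r₁ r₂) := fun ρ hρ => by
    have hρ0 : 0 < ρ := hr₁.trans hρ.1
    simp only
    rw [hD ρ hρ0, ENNReal.mul_top (ENNReal.ofReal_pos.2 (inv_pos.2 hρ0)).ne']
  rw [setLIntegral_congr_fun measurableSet_Ioo h, setLIntegral_const, Real.volume_Ioo,
    ENNReal.top_mul (ENNReal.ofReal_pos.2 (sub_pos.2 hr)).ne']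

/-! ### The kill -/

/-- **¬ Step29E_AlmostMono** (§2.9 p.6 l.36–56 = companion (63)–(64), honest carrier): for every `ν > 0`,
`λ > 0` and every admissible cutoff `χ`, the Kato solution off `c₀ · u₀^{Godoi}` is a member of the print's
class whose square term `D(ρ; z0)` is `+∞` at a point of non-vanishing for every `ρ > 0`, so no constants
`c, C, α, r* > 0` satisfy the printed integrated almost-monotonicity inequality. -/
theorem not_Step29E_AlmostMono {ν lam : ℝ} (hν : 0 < ν) (hlam : 0 < lam) {χ : ℝ → ℝ} (hχ : IsCutoff χ) :
    ¬ Step29E_AlmostMono ν lam χ := by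
  intro h29
  obtain ⟨u₀, u, p, hu, hp, hns, hE, z0, δ, m, K, hδ, hδt, hm, hK, hnear⟩ :=
    exists_clay_solution_nonvanishing hν
  have ht0 : 0 < z0.1 := lt_of_lt_of_le hδ hδt
  have hT : 0 < z0.1 + 1 := by linarith
  -- the classical gradient
  set G : ℝ → E3 → E3 →L[ℝ] E3 := fun t x => fderiv ℝ (u t) x with hGdef
  have hsol : IsSolution ν (z0.1 + 1) u p G := isSolution_of_clay hν hT hns hu hp hE
  have hz0 : z0 ∈ (slab (z0.1 + 1) : Set (ℝ × E3)) := by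
    simp only [Literature.Claims.NS.Taghizadeh2026.slab, TopologicalSpace.Opens.coe_mk]
    exact ⟨⟨ht0, by linarith⟩, mem_univ _⟩
  obtain ⟨c, C, α, rs, hc, -, -, hrs, hineq, -⟩ := h29 hν hlam hχ (z0.1 + 1) u p G hsol z0 hz0
  have hB : ∀ z : ℝ × E3, dist z z0 < δ → m ≤ ‖u z.1 z.2‖ ∧ frobeniusNormSq (G z.1 z.2) ≤ 3 * K ^ 2 := by
    intro z hz
    obtain ⟨h1, -, h3⟩ := hnear z hz
    refine ⟨h1, (Literature.Analysis.FluidPDE.frobeniusNormSq_le_three_mul (G z.1 z.2)).trans ?_⟩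
    have h3' : ‖G z.1 z.2‖ ≤ K := h3
    exact mul_le_mul_of_nonneg_left (pow_le_pow_left₀ (norm_nonneg _) h3' 2) (by norm_num)
  have hD : ∀ ρ : ℝ, 0 < ρ → DfunE ν χ ρ z0 u G = ⊤ :=
    fun ρ hρ => DfunE_eq_top (u := u) (G := G) hν hχ hδ hm (by positivity : (0:ℝ) ≤ 3 * K ^ 2) hB hρ
  have hsq : sqTermE ν χ (rs / 4) (rs / 2) z0 u G = ⊤ :=
    sqTermE_eq_top hD (by positivity : 0 < rs / 4) (by linarith : rs / 4 < rs / 2)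
  have key : ENNReal.ofReal c * sqTermE ν χ (rs / 4) (rs / 2) z0 u G ≤
      ENNReal.ofReal (Ifun ν lam χ (rs / 2) z0 u p G - Ifun ν lam χ (rs / 4) z0 u p G +
        C * ∫ ρ in (rs / 4)..(rs / 2), ρ ^ α) :=
    hineq (rs / 4) (rs / 2) (by positivity) (by linarith) (by linarith)
  have hc' : ENNReal.ofReal c ≠ 0 := (ENNReal.ofReal_pos.2 hc).ne'
  rw [hsq, ENNReal.mul_top hc'] at key
  exact ENNReal.ofReal_ne_top (top_le_iff.1 key)

end KillE

/-- **C166 headline (rev 2, honest carrier): the imported almost-monotonicity formula §2.9 / companion (63)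
is false in the print's own solution class**, for every viscosity `ν > 0`, every `λ > 0` and every admissible
cutoff `χ`. Binder 1 of `claim_of_stepsE` / `claim_of_stepsE'` / `claim_of_steps_fine`. -/
theorem not_Step29E (ν lam : ℝ) (hν : 0 < ν) (hlam : 0 < lam) (χ : ℝ → ℝ)
    (hχ : Literature.Claims.NS.Taghizadeh2026.IsCutoff χ) :
    ¬ Literature.Claims.NS.Taghizadeh2026.Step29E_AlmostMono ν lam χ :=
  KillE.not_Step29E_AlmostMono hν hlam hχ

end Summit.NavierStokesRegularity.NavierStokesRegularity.Theorems.Taghizadeh2026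

end
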